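import Literature.MathematicalPhysics.QuantumFieldTheory.Balaban1983to89.Beta.RemainderDecay190SectGBlocks

/-!
# [Balaban1987RG1] p. 282 ↔ [Balaban1985Variational] (190): the (T12) DICTIONARY LETTERS `hm` ∕ `hD` of the (190)-socket
# `Data190` DISCHARGED on the cube-torus block carrier with δ source fields — m = 1, θ·M ≤ 1 (`Beta.RemainderDecay190Dictionary`)

statement-level skeleton of published theorems with citation tags; proofs where landed; nothing here is a claim
about the Yang–Mills mass gap.

HONEST FRAMING (cell rule).  Bookkeeping for the k-uniform remainder chain of row (D4) (`RemainderConst` ⇐ ONE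
`ChainTFac190` instance, `Beta.RemainderDecay190`); discharges NOTHING of `BetaPertH`; NOT B12 Thm 2, NOT the continuum
limit, NOT Clay.  Unit `b2b-balaban-beta-an4` gen 93 (BINDER row D4 OWNER; cell pub-balaban).  Imports
`Beta.RemainderDecay190SectGBlocks` (gen 92) ONLY; nothing edited.

WHAT.  The (190)-socket `RemainderDecay190.Data190 d M N Wn q` carries, besides NODE D's subject `dHn` with (190) `h190`,
THREE DICTIONARY LETTERS between [I] p. 282 (*"if one of the functions B_i is localized outside the domain X, then we
have the additional exponential factor exp(−δ₀dist^{(ξ)}(X, supp B_i))"*, *"can be estimated by B₃∏∣B_i∣"*) and the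
block vocabulary of [15] (190) / [3] (2.46): `hm` (the unit source fields `un n x` have B-size ≤ m), `hD`
(`B12Decay510FromB11.UnitFieldsLocalised`: the B-size of `un n x` vanishes on every block y′ with d(y, y′) < θ·dist(x, X̄)
for the blocks y meeting X̄ — θ the UNPRINTED conversion factor between dist^{(ξ)} and d(y, y′), cell DIVERGENCE
D-b03.12 (i), GAPS G-IF-06) and `hdom` (domination of the (4.4)-norm).  They are tagged NOT-IN-PRINT in the owner table
`HOME/b2b-balaban-beta-an4/D4-INSTANCE-LINKS.md` §3 ((T12): a cell CONVENTION).  THIS FILE fixes the convention on the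
carrier of the tree's NODE-O block road (generation 92's torus of BLOCKS `UT Nf`, d₁ = `tdist1`, sharp block sizes
`B11SectG.BlockNorm.ofBlocks`) and PROVES two of the three letters there:
* §1 (ℤ and ℤ^d) `distI_le_mul_abs_cubeOf_sub`, `distCube_le_mul_l1_cubeOf_sub` — the UPPER bound companion of
  `B12Decay510Lattice.l1_cubeOf_sub_le_distCube`: dist(x, □_z) ≤ M·∣⌊x∕M⌋ − z∣₁ (no additive constant).
* §2 (the torus with N·M sites per direction) `distCT_le_mul_pl1_tcubeOf_sub`: dist(x, □_c) ≤ M·∣cube(x) − c∣ — the upper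
  companion of `B12Decay510Torus.pl1_tcubeOf_sub_le_distCT`; hence `distD_geomT_le_mul_pl1`: the p. 282 distance
  `(geomT d N M).distD x X̄` is ≤ M·∣cube(x) − c∣ for EVERY cube c of X̄.
* §3 (the block-index identification) `circAbs_val_sub_val` (the torus distance of `B4TorusKernel` on representatives
  = ∣valMinAbs∣ of `B12Decay510Torus`) and `tdist1_finOfVal_eq_pl1`: the canonical identification
  ê : (ℤ∕N)^d → Π_i Fin N, `a ↦ (i ↦ ⟨(a i).val, _⟩)`, is an ISOMETRY from ∣· − ·∣ (`pl1`) to d₁ (`tdist1`).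
* §4 (δ source fields in the sharp block sizes) `loc_ofBlocks_single`: the block size of δ_x at y′ is 1 if blk x = y′
  and 0 otherwise; so `hm` holds with m = 1 (`loc_ofBlocks_single_le_one`) and a non-zero size locates the block
  (`blk_eq_of_loc_ofBlocks_single_ne_zero`).
* §5 `unitFieldsLocalised_single` — THE LETTER `hD` AS A THEOREM: for any block-index map `e : (ℤ∕N)^d → UT Nf` that does
  not shrink distances (`∣a − b∣ ≤ d₁(e a, e b)`; ê is an isometry, §3), B-lattice = functions on the fine torus
  `TPt d (N·M)` with block map `e ∘ cube`, blocks meeting X̄ := `e''(cubes of X̄)`, source fields `u x := δ_x`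
  (`Pi.single x 1`), and ANY θ ≥ 0 with θ·M ≤ 1: `UnitFieldsLocalised (ofBlocks … (e ∘ cube)) (geomT d N M) (e''·) δ θ`;
  `unitFieldsLocalised_single_val` the same for ê with no letter left.
* §6 `nonempty_data190_of_sectG_blocks_single` — generation 91's JOIN CERTIFICATE `nonempty_data190_of_sectG_torusGeom`
  on this carrier with `hm`, `hD`, `hκB` FILLED: the (190)-socket is inhabited from the per-torus Sect. G letters (B-side
  sizes = the sharp block sizes of the fine torus over the block torus), the ONE remaining dictionary letter `hdom`
  (domination of the (4.4)-norm of X̄ by the local sizes over the blocks `e''(cubes of X̄)` — NODE B's choice of `Wn`), the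
  numerics of generation 91 and `1 ≤ q.m`, `0 ≤ q.θ`, `q.θ·M ≤ 1`, `1 ≤ q.κB`.
CONVENTION FIXED HERE (the (T12) item, owner's ruling for THIS carrier): B-data = real functions on the fine torus; the
source field B_i of (4.35)∕(5.1) at the site x is δ_x; its B-size is the sharp sup over the block (so m = 1); blocks =
M-cubes read in the block torus through e; θ = 1∕M converts the SITE distance of p. 282 into the CUBE distance d₁ of the
block torus (any smaller θ ≥ 0 is admissible).  For Bałaban's own 𝔅_k (multiscale) the dictionary is NODE O's choice;
nothing of it is asserted here.
WHAT IS *NOT* DONE: `hdom` stays a hypothesis (it quantifies over NODE B's (4.4)-space `Wn`); no operator of Bałaban's is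
constructed; row D4 class UNCHANGED (instance 0∕1; critical-path width 0 = NODE O; D4 DISCHARGE NO DATE).  No `def`, no
named fact, no `sorry`, standard axioms.
HONEST DEPENDENCY: continuum YM on T⁴ ⇐ BetaPertH ∧ nine spine estimates (0/9 proved); BetaPertH ⇐ (D1) ∧ (D4) ∧
CAP+tail; G-an2-4 gates asym, D1 and NE2/3/4.

Sources: [I] = T. Bałaban, *Renormalization group approach to lattice gauge field theories. I*, Commun. Math. Phys.
**109** (1987) 249–301 [Balaban1987RG1], §0 p. 257 (the cubes of side M of the torus), (4.4) p. 281, p. 282, (5.10)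
p. 293; [15] = *The variational problem and background fields in renormalization group method for lattice gauge
theories*, Commun. Math. Phys. **102** (1985) 277–309 [Balaban1985Variational], (190) p. 308; [3] = *Propagators and
renormalization transformations for lattice gauge theories. II*, Commun. Math. Phys. **96** (1984) 223–250
[Balaban1984PropagatorsII], (2.46) p. 231, Lemma 2.1 (2.61) p. 234.
-/

namespace Literature.MathematicalPhysics.QuantumFieldTheory.Balaban1983to89.Beta.RemainderDecay190Dictionary

open Literature.MathematicalPhysics.QuantumFieldTheory.Balaban1983to89 B11SectG B6RandomWalk
open Literature.MathematicalPhysics.QuantumFieldTheory.Balaban1983to89.B9Thm34Ext (toB6)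
open Literature.MathematicalPhysics.QuantumFieldTheory.Balaban1983to89.B9Thm37GlueTorus (torusGeom tdist1 tdist1_comm)
open Literature.MathematicalPhysics.QuantumFieldTheory.Balaban1983to89.B5TorusCover (UT)
open Literature.MathematicalPhysics.QuantumFieldTheory.Balaban1983to89.B13ScaleTransfer (Pt)
open Literature.MathematicalPhysics.QuantumFieldTheory.Balaban1983to89.B12Sec2to5 (l1 l1_nonneg)
open Literature.MathematicalPhysics.QuantumFieldTheory.Balaban1983to89.TreeLengthTorus
  (TPt TDom tsys proj proj_apply natLift proj_natLift)
open Literature.MathematicalPhysics.QuantumFieldTheory.Balaban1983to89.B12Decay510Torus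
  (pabs pabs_nonneg pl1 pl1_eq_sum pl1_nonneg vmaVec proj_vmaVec proj_sub pl1_proj_le_l1 pl1_sub_comm tcubeOf tcubeOf_eq
    proj_cubeOf_of_proj_eq distCT distCT_le distCT_nonneg nearT nearT_le nearT_mem geomT geomT_distD)
open Literature.MathematicalPhysics.QuantumFieldTheory.Balaban1983to89.B12Decay510FromB11 (NormDominated UnitFieldsLocalised)
open Literature.MathematicalPhysics.QuantumFieldTheory.Balaban1983to89.Beta.RemainderDecay190 (Data190 Consts190)
open Literature.MathematicalPhysics.QuantumFieldTheory.Balaban1983to89.Beta.RemainderDecay190SectGTorus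
  (h190_of_sectG_torusGeom hdist_torusGeom)
open Literature.MathematicalPhysics.QuantumFieldTheory.Balaban1983to89.Beta.RemainderRowSum (hrow_torusGeom)

/-! ## 1. ℤ and ℤ^d: the distance to a cube is at most M times the cube-index distance -/

section Lattice

open Literature.MathematicalPhysics.QuantumFieldTheory.Balaban1983to89.B12Decay510Lattice
  (distI clo chi cubeOf distCube distCubeZ mem_cube_cubeOf cubeOf_proj l1_sub_proj)

variable {d M : ℕ}

/-- **One coordinate, upper bound**: dist(xᵢ, [M zᵢ, M zᵢ + M − 1]) ≤ M·∣⌊xᵢ∕M⌋ − zᵢ∣ for M ≥ 1 — if ⌊xᵢ∕M⌋ = zᵢ the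
site lies in the interval; otherwise the nearer end of the interval is within M·(index difference) of xᵢ.  The upper
companion of `B12Decay510Lattice.abs_cubeOf_sub_le_distI` (elementary; locus = the cubes of side M of the torus).
[cite: Balaban1987RG1, §0 p.257] -/
theorem distI_le_mul_abs_cubeOf_sub (hM : 0 < M) (x z : Pt d) (i : Fin d) :
    distI (clo M z i) (chi M z i) (x i) ≤ (M : ℤ) * |cubeOf M x i - z i| := by
  obtain ⟨h1, h2⟩ := mem_cube_cubeOf hM x i
  unfold B12Decay510Lattice.clo at h1 ⊢
  unfold B12Decay510Lattice.chi at h2 ⊢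
  have hM0 : (0 : ℤ) < M := by exact_mod_cast hM
  set c := cubeOf M x i with hc
  unfold B12Decay510Lattice.distI
  rcases lt_trichotomy (z i) c with hlt | heq | hgt
  · have hk : (1 : ℤ) ≤ c - z i := by omega
    have hMk : (M : ℤ) ≤ M * c - M * z i := by rw [← mul_sub]; exact le_mul_of_one_le_right hM0.le hk
    rw [abs_of_pos (by omega), mul_sub]
    refine max_le ?_ (max_le ?_ ?_) <;> linarith
  · rw [heq, sub_self, abs_zero, mul_zero]
    refine max_le ?_ (max_le le_rfl ?_) <;> linarith
  · have hk : (1 : ℤ) ≤ z i - c := by omega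
    have hMk : (M : ℤ) ≤ M * z i - M * c := by rw [← mul_sub]; exact le_mul_of_one_le_right hM0.le hk
    rw [abs_of_neg (by omega), neg_sub, mul_sub]
    refine max_le ?_ (max_le ?_ ?_) <;> linarith

/-- **ℤ^d, upper bound**: dist(x, □_z) ≤ M·∣⌊x∕M⌋ − z∣₁ — the upper companion of
`B12Decay510Lattice.l1_cubeOf_sub_le_distCube` (together: the distance from a site to a cube and the index distance of
the cubes are comparable with constants 1 and M, no additive term; elementary; locus = the cubes of side M).
[cite: Balaban1987RG1, §0 p.257] -/
theorem distCube_le_mul_l1_cubeOf_sub (hM : 0 < M) (x z : Pt d) :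
    distCube M x z ≤ (M : ℝ) * l1 (cubeOf M x - z) := by
  unfold B12Decay510Lattice.distCube B12Decay510Lattice.distCubeZ B12Sec2to5.l1
  rw [Int.cast_sum, Finset.mul_sum]
  refine Finset.sum_le_sum fun i _ => ?_
  rw [Pi.sub_apply, ← Int.cast_abs]
  exact_mod_cast distI_le_mul_abs_cubeOf_sub hM x z i

end Lattice

/-! ## 2. The torus with N·M sites per direction: dist(x, □_c) ≤ M·∣cube(x) − c∣ -/

section FineTorus

open Literature.MathematicalPhysics.QuantumFieldTheory.Balaban1983to89.B12Decay510Lattice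
  (cubeOf distCube cubeOf_proj l1_sub_proj)

variable {d N M : ℕ} [NeZero N] [NeZero M]

/-- **The torus, upper bound**: dist(x, □_c) ≤ M·∣cube(x) − c∣ (periodic ℓ¹ distances; ∣·∣ on the cube indices
(ℤ∕N)^d) — lift x to [0, NM)^d, move its cube index by the MINIMAL representative of cube(x) − c to an integer cube Z
projecting to c, clamp the lift into Z (`B12Decay510Lattice.proj`), project the clamped site back to the torus: it lies
in □_c and is within M·∣cube(x) − c∣ of x by §1; projecting never lengthens.  The upper companion of
`B12Decay510Torus.pl1_tcubeOf_sub_le_distCT`. [cite: Balaban1987RG1, §0 p.257] -/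
theorem distCT_le_mul_pl1_tcubeOf_sub (p : TPt d (N * M)) (c : TPt d N) :
    distCT N M p c ≤ (M : ℝ) * pl1 (tcubeOf N M p - c) := by
  have hM : 0 < M := Nat.pos_of_neZero M
  -- the integer cube Z := ⌊lift p ∕ M⌋ − valMinAbs(cube(p) − c) projects to c
  have hZc : proj N (cubeOf M (natLift p) - vmaVec (tcubeOf N M p - c)) = c := by
    rw [proj_sub, ← tcubeOf_eq (N := N) (M := M) p, proj_vmaVec, sub_sub_cancel]
  -- the clamped site projects into □_c
  have hq : tcubeOf N M (proj (N * M)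
      (B12Decay510Lattice.proj M (cubeOf M (natLift p) - vmaVec (tcubeOf N M p - c)) (natLift p))) = c := by
    rw [← proj_cubeOf_of_proj_eq
      (P := B12Decay510Lattice.proj M (cubeOf M (natLift p) - vmaVec (tcubeOf N M p - c)) (natLift p)) rfl,
      cubeOf_proj hM, hZc]
  calc distCT N M p c
      ≤ pl1 (p - proj (N * M)
          (B12Decay510Lattice.proj M (cubeOf M (natLift p) - vmaVec (tcubeOf N M p - c)) (natLift p))) :=
        distCT_le hq
    _ = pl1 (proj (N * M) (natLift p -
          B12Decay510Lattice.proj M (cubeOf M (natLift p) - vmaVec (tcubeOf N M p - c)) (natLift p))) := by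
        rw [proj_sub, proj_natLift]
    _ ≤ l1 (natLift p -
          B12Decay510Lattice.proj M (cubeOf M (natLift p) - vmaVec (tcubeOf N M p - c)) (natLift p)) :=
        pl1_proj_le_l1 _
    _ = distCube M (natLift p) (cubeOf M (natLift p) - vmaVec (tcubeOf N M p - c)) := l1_sub_proj hM _ _
    _ ≤ (M : ℝ) * l1 (cubeOf M (natLift p) - (cubeOf M (natLift p) - vmaVec (tcubeOf N M p - c))) :=
        distCube_le_mul_l1_cubeOf_sub hM _ _
    _ = (M : ℝ) * pl1 (tcubeOf N M p - c) := by rw [sub_sub_cancel]; rfl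

/-- **The p. 282 distance of a site to a localization domain is at most M times the cube-index distance to ANY of
its cubes**: `(geomT d N M).distD x X̄ ≤ M·∣cube(x) − c∣` for every cube c of X̄ (the distance to X̄ is the distance to
its nearest cube, `B12Decay510Torus.nearT_le`, then `distCT_le_mul_pl1_tcubeOf_sub`). [cite: Balaban1987RG1, p.282] -/
theorem distD_geomT_le_mul_pl1 (p : TPt d (N * M)) (X : TDom d N) {c : TPt d N} (hc : c ∈ X.1) :
    (geomT d N M).distD p X ≤ (M : ℝ) * pl1 (tcubeOf N M p - c) := by
  rw [geomT_distD]
  exact (nearT_le (M := M) p X hc).trans (distCT_le_mul_pl1_tcubeOf_sub p c)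

end FineTorus

/-! ## 3. The block-index identification (ℤ∕N)^d → Π_i Fin N is an isometry -/

section Ident

open Literature.MathematicalPhysics.QuantumFieldTheory.Balaban1983to89.B4TorusKernel.MultiPeriod
  (circAbs circAbs_add_mul circAbs_of_centred)
open Literature.MathematicalPhysics.QuantumFieldTheory.Balaban1983to89.B4Sect5Torus (ccoord ccoord_cast)

variable {d N : ℕ} [NeZero N]

/-- **The two periodic absolute values of the tree agree**: for residues a, b ∈ ℤ∕N, the torus distance
`circAbs N (val a − val b)` of `B4TorusKernel` (= min(r mod N, N − r mod N)) IS ∣a − b∣_N = ∣valMinAbs (a − b)∣ of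
`B12Decay510Torus` — the minimal representative is a representative (`circAbs_add_mul`) and is centred
(`ZMod.natAbs_valMinAbs_le`, `circAbs_of_centred`); elementary; locus = the lattice distance (2.46) at one scale on the
torus. [cite: Balaban1984PropagatorsII, (2.46) p.231] -/
theorem circAbs_val_sub_val (a b : ZMod N) : circAbs N (((a.val : ℕ) : ℤ) - ((b.val : ℕ) : ℤ)) = pabs (a - b) := by
  have hN : 1 ≤ N := Nat.one_le_iff_ne_zero.mpr (NeZero.ne N)
  have hcast : ((((a.val : ℕ) : ℤ) - ((b.val : ℕ) : ℤ) : ℤ) : ZMod N) = (((a - b).valMinAbs : ℤ) : ZMod N) := by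
    rw [ZMod.coe_valMinAbs]
    push_cast
    rw [ZMod.natCast_zmod_val, ZMod.natCast_zmod_val]
  obtain ⟨j, hj⟩ := B12Decay510Torus.exists_eq_add_mul_of_cast_eq hcast
  have h2 : 2 * |(a - b).valMinAbs| ≤ (N : ℤ) := by
    have h := ZMod.natAbs_valMinAbs_le (a - b)
    have h' : 2 * (a - b).valMinAbs.natAbs ≤ N := by omega
    rw [← Int.natCast_natAbs]
    exact_mod_cast h'
  calc circAbs N (((a.val : ℕ) : ℤ) - ((b.val : ℕ) : ℤ))
      = circAbs N ((((a.val : ℕ) : ℤ) - ((b.val : ℕ) : ℤ)) + N * j) := (circAbs_add_mul N _ j).symm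
    _ = circAbs N (a - b).valMinAbs := by rw [hj]; ring_nf
    _ = |(a - b).valMinAbs| := circAbs_of_centred hN h2
    _ = pabs (a - b) := rfl

/-- **The canonical identification ê : (ℤ∕N)^d → Π_i Fin N, a ↦ (i ↦ ⟨val (a i), ·⟩), is an isometry from the periodic
ℓ¹ distance ∣a − b∣ (`B12Decay510Torus.pl1`) to d₁ (`B9Thm37GlueTorus.tdist1`)** — coordinatewise `circAbs_val_sub_val`.
[cite: Balaban1984PropagatorsII, (2.46) p.231] -/
theorem tdist1_finOfVal_eq_pl1 (a b : TPt d N) :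
    tdist1 (fun _ : Fin d => N) (fun i => (⟨(a i).val, ZMod.val_lt (a i)⟩ : Fin N))
      (fun i => (⟨(b i).val, ZMod.val_lt (b i)⟩ : Fin N)) = pl1 (a - b) := by
  have hN1 : ∀ i : Fin d, 1 ≤ (fun _ : Fin d => N) i := fun _ => Nat.one_le_iff_ne_zero.mpr (NeZero.ne N)
  unfold tdist1
  rw [pl1_eq_sum]
  refine Finset.sum_congr rfl fun i _ => ?_
  have h : ((ccoord (fun _ : Fin d => N) (UT.toSite _ (fun i => (⟨(a i).val, ZMod.val_lt (a i)⟩ : Fin N)))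
      (UT.toSite _ (fun i => (⟨(b i).val, ZMod.val_lt (b i)⟩ : Fin N))) i : ℕ) : ℤ) =
      circAbs N (((a i).val : ℤ) - ((b i).val : ℤ)) := ccoord_cast hN1 _ _ i
  have key : ((ccoord (fun _ : Fin d => N) (UT.toSite _ (fun i => (⟨(a i).val, ZMod.val_lt (a i)⟩ : Fin N)))
      (UT.toSite _ (fun i => (⟨(b i).val, ZMod.val_lt (b i)⟩ : Fin N))) i : ℕ) : ℤ) = pabs ((a - b) i) := by
    rw [h, Pi.sub_apply]
    exact circAbs_val_sub_val (a i) (b i)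
  exact_mod_cast congrArg (fun t : ℤ => (t : ℝ)) key

/-- Hence ê does not shrink distances (the letter `he` of §5 for ê): ∣a − b∣ ≤ d₁(ê a, ê b) (elementary).
[cite: Balaban1984PropagatorsII, (2.46) p.231] -/
theorem pl1_le_tdist1_finOfVal (a b : TPt d N) :
    pl1 (a - b) ≤ tdist1 (fun _ : Fin d => N) (fun i => (⟨(a i).val, ZMod.val_lt (a i)⟩ : Fin N))
      (fun i => (⟨(b i).val, ZMod.val_lt (b i)⟩ : Fin N)) :=
  (tdist1_finOfVal_eq_pl1 a b).ge

end Ident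

/-! ## 4. δ source fields in the sharp block sizes: m = 1 and the size locates the block -/

section Single

variable {g : B6.Geometry} {X : Type} [Fintype X] [DecidableEq X]

open Classical in
/-- **The block size of a δ source field**: in the sharp block sizes `BlockNorm.ofBlocks g blk` (sup over the block),
the size at y′ of δ_x (`Pi.single x 1`) is 1 if the block of x is y′ and 0 otherwise (the `if` read classically, as
inside `BlockNorm.ofBlocks`); elementary; locus = the block localisation *"supp 𝔄 ⊂ Δ̃(y′)"* of (189)–(190).
[cite: Balaban1985Variational, (189)-(190) p.308] -/
theorem loc_ofBlocks_single (blk : X → g.Site) (x : X) (y' : g.Site) :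
    (BlockNorm.ofBlocks g blk).loc y' (Pi.single x (1 : ℝ)) = if blk x = y' then 1 else 0 := by
  have h : (BlockNorm.ofBlocks g blk).loc y' (Pi.single x (1 : ℝ)) =
      ⨆ x' : X, @ite ℝ (blk x' = y') (Classical.propDecidable _) |(Pi.single x (1 : ℝ) : X → ℝ) x'| 0 := rfl
  haveI : Nonempty X := ⟨x⟩
  rw [h]
  refine le_antisymm (ciSup_le fun x' => ?_) ?_
  · by_cases hx' : blk x' = y'
    · rw [if_pos hx']
      by_cases hxx : x' = x
      · subst hxx
        rw [if_pos hx', Pi.single_eq_same, abs_one]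
      · rw [Pi.single_eq_of_ne hxx, abs_zero]
        split_ifs <;> norm_num
    · rw [if_neg hx']
      split_ifs <;> norm_num
  · by_cases hx : blk x = y'
    · rw [if_pos hx]
      exact le_ciSup_of_le (Finite.bddAbove_range _) x (by rw [if_pos hx, Pi.single_eq_same, abs_one])
    · rw [if_neg hx]
      exact le_ciSup_of_le (Finite.bddAbove_range _) x (by rw [if_neg hx])

open Classical in
/-- **`hm` with m = 1**: the block size of a δ source field is ≤ 1 everywhere. [cite: Balaban1987RG1, p.282] -/
theorem loc_ofBlocks_single_le_one (blk : X → g.Site) (x : X) (y' : g.Site) :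
    (BlockNorm.ofBlocks g blk).loc y' (Pi.single x (1 : ℝ)) ≤ 1 := by
  rw [loc_ofBlocks_single]
  split_ifs <;> norm_num

open Classical in
/-- A non-zero block size of δ_x at y′ LOCATES the block: blk x = y′ (elementary; locus = the block localisation of
(189)–(190)). [cite: Balaban1985Variational, (189)-(190) p.308] -/
theorem blk_eq_of_loc_ofBlocks_single_ne_zero {blk : X → g.Site} {x : X} {y' : g.Site}
    (h : (BlockNorm.ofBlocks g blk).loc y' (Pi.single x (1 : ℝ)) ≠ 0) : blk x = y' := by
  by_contra hne
  rw [loc_ofBlocks_single, if_neg hne] at h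
  exact h rfl

end Single

/-! ## 5. THE LETTER `hD` AS A THEOREM on the cube-torus block carrier -/

section Localised

variable {d Nc Mc : ℕ} [NeZero Nc] [NeZero Mc] {ν : ℕ} {Nf : Fin ν → ℕ} [∀ i, NeZero (Nf i)]
  {η L Mg R : ℝ} {H : Prop}

/-- **`Data190.hD` DISCHARGED** ([I] p. 282 *"the additional exponential factor exp(−δ₀dist^{(ξ)}(X, supp B_i))"* in
the block vocabulary of [15] (190) ∕ [3] (2.46)): on the block torus `UT Nf` (d₁ = `tdist1`, the `toB6` repackaging of
`torusGeom`), with ANY block-index map `e : (ℤ∕N)^d → UT Nf` that does not shrink distances (`he`; the canonical ê is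
an isometry, §3), B-data = real functions on the fine torus `TPt d (N·M)` with the sharp block sizes of the block map
`e ∘ cube`, blocks meeting X̄ := `e''(cubes of X̄)`, source fields δ_x, and any `0 ≤ θ` with `θ·M ≤ 1`: the B-size of δ_x
is non-zero only at y′ = e(cube x) (§4), and for every cube c of X̄, `θ·dist(x, X̄) ≤ θ·M·∣cube x − c∣ ≤ d₁(e c, e(cube x))`
(§2 + `he`). [cite: Balaban1987RG1, p.282; Balaban1984PropagatorsII, (2.46) p.231] -/
theorem unitFieldsLocalised_single (e : TPt d Nc → UT Nf)
    (he : ∀ a b : TPt d Nc, pl1 (a - b) ≤ tdist1 Nf (e a) (e b)) {θ : ℝ} (hθ : 0 ≤ θ) (hθM : θ * Mc ≤ 1) :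
    UnitFieldsLocalised
      (BlockNorm.ofBlocks (toB6 (torusGeom Nf η L Mg) R H) (fun x : TPt d (Nc * Mc) => e (tcubeOf Nc Mc x)))
      (geomT d Nc Mc) (fun X : TDom d Nc => (X.1.image e : Finset (UT Nf))) (fun x => Pi.single x (1 : ℝ)) θ := by
  -- typeclass synthesis does not unfold `toB6`: name the block torus's decidable equality on `g.Site`
  letI : DecidableEq (toB6 (torusGeom Nf η L Mg) R H).Site := inferInstanceAs (DecidableEq (UT Nf))
  intro X x y hy y' hne
  have hy' : e (tcubeOf Nc Mc x) = y' :=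
    blk_eq_of_loc_ofBlocks_single_ne_zero (g := toB6 (torusGeom Nf η L Mg) R H)
      (blk := fun x : TPt d (Nc * Mc) => e (tcubeOf Nc Mc x)) (x := x) hne
  obtain ⟨c, hc, rfl⟩ := Finset.mem_image.mp hy
  rw [← hy']
  show θ * (geomT d Nc Mc).distD x X ≤ tdist1 Nf (e c) (e (tcubeOf Nc Mc x))
  have h1 : (geomT d Nc Mc).distD x X ≤ (Mc : ℝ) * pl1 (tcubeOf Nc Mc x - c) := distD_geomT_le_mul_pl1 x X hc
  have h2 : pl1 (tcubeOf Nc Mc x - c) ≤ tdist1 Nf (e c) (e (tcubeOf Nc Mc x)) := by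
    rw [pl1_sub_comm]; exact he c _
  calc θ * (geomT d Nc Mc).distD x X ≤ θ * ((Mc : ℝ) * pl1 (tcubeOf Nc Mc x - c)) :=
        mul_le_mul_of_nonneg_left h1 hθ
    _ = (θ * Mc) * pl1 (tcubeOf Nc Mc x - c) := by ring
    _ ≤ 1 * pl1 (tcubeOf Nc Mc x - c) := mul_le_mul_of_nonneg_right hθM (pl1_nonneg _)
    _ ≤ tdist1 Nf (e c) (e (tcubeOf Nc Mc x)) := by rw [one_mul]; exact h2

/-- **`hD` for the canonical identification ê, no letter left**: block torus `UT (fun _ => N)` (the cube torus itself,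
read in `Π_i Fin N`), block map ê ∘ cube, blocks meeting X̄ = ê''(cubes of X̄), δ source fields, `0 ≤ θ`, `θ·M ≤ 1`.
[cite: Balaban1987RG1, p.282; Balaban1984PropagatorsII, (2.46) p.231] -/
theorem unitFieldsLocalised_single_val {η L Mg R : ℝ} {H : Prop} {θ : ℝ} (hθ : 0 ≤ θ) (hθM : θ * Mc ≤ 1) :
    UnitFieldsLocalised
      (BlockNorm.ofBlocks (toB6 (torusGeom (fun _ : Fin d => Nc) η L Mg) R H)
        (fun x : TPt d (Nc * Mc) => fun i => (⟨(tcubeOf Nc Mc x i).val, ZMod.val_lt (tcubeOf Nc Mc x i)⟩ : Fin Nc)))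
      (geomT d Nc Mc)
      (fun X : TDom d Nc =>
        (X.1.image fun a : TPt d Nc => fun i => (⟨(a i).val, ZMod.val_lt (a i)⟩ : Fin Nc) :
          Finset (UT (fun _ : Fin d => Nc))))
      (fun x => Pi.single x (1 : ℝ)) θ :=
  unitFieldsLocalised_single (Nf := fun _ : Fin d => Nc)
    (fun a : TPt d Nc => fun i => (⟨(a i).val, ZMod.val_lt (a i)⟩ : Fin Nc)) pl1_le_tdist1_finOfVal hθ hθM

end Localised

/-! ## 6. JOIN CERTIFICATE on the cube-torus block carrier: `hm`, `hD`, `hκB` filled; `hdom` the one dictionary letter left -/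

section Certificate

variable {ν : ℕ} {Nf : ℕ → Fin ν → ℕ} [∀ n i, NeZero (Nf n i)] {η L Mg R : ℕ → ℝ} {H : ℕ → Prop}
variable {d Mc : ℕ} [NeZero Mc] {N : ℕ → ℕ} [∀ n, NeZero (N n)] {Wn : ℕ → Type} [∀ n, NormedAddCommGroup (Wn n)]
  {q : Consts190} {I : Type} {FA F3 : ℕ → Type}
  [∀ n, AddCommGroup (FA n)] [∀ n, Module ℝ (FA n)] [∀ n, AddCommGroup (F3 n)] [∀ n, Module ℝ (F3 n)]

/-- **JOIN CERTIFICATE WITH THE (T12) LETTERS `hm` ∕ `hD` DISCHARGED** — generation 91's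
`RemainderDecay190SectGTorus.nonempty_data190_of_sectG_torusGeom` on the carrier: block torus `UT (Nf n)` per step,
B-data := real functions on the fine torus `TPt d (N n·M)` with the SHARP block sizes of the block map `e n ∘ cube`
(`e n` any non-shrinking block-index map, `he`), source fields `un n x := δ_x`, blocks meeting X̄ := `(e n)''(cubes of X̄)`.
INPUTS: the per-torus Sect. G letters exactly as in generation 91 (the B-side sizes now being the sharp block sizes, so
`hκB` reads `1 ≤ q.κB`), the numerics `0 < q.σ ≤ ⅛δ₀`, `c₀(q.σ∕δ₀)^ν ≤ q.cR`, and — of the three (4.4)-dictionary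
letters — ONLY `hdom` (domination of the (4.4)-norm of X̄ in NODE B's space `Wn n` by the local sizes over the blocks
`(e n)''(cubes of X̄)`); `hm` and `hD` are §4 ∕ §5 under `1 ≤ q.m`, `0 ≤ q.θ`, `q.θ·M ≤ 1`.  OUTPUT:
`Nonempty (Data190 d M N Wn q)`.  Nothing of Bałaban's is constructed: the operators, the A-side sizes, `e`, `ι` are
parameters (NODE O ∕ NODE B); no `def` is introduced.
[cite: Balaban1985Variational, (190) p.308; Balaban1987RG1, (4.4) p.281 and p.282; Balaban1984PropagatorsII, (2.46) p.231, (2.61) p.234] -/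
theorem nonempty_data190_of_sectG_blocks_single
    (e : (n : ℕ) → TPt d (N n) → UT (Nf n))
    (he : ∀ n (a b : TPt d (N n)), pl1 (a - b) ≤ tdist1 (Nf n) (e n a) (e n b))
    (bN : (n : ℕ) → BlockNorm (toB6 (torusGeom (Nf n) (η n) (L n) (Mg n)) (R n) (H n)) (FA n))
    (b3 : (n : ℕ) → BlockNorm (toB6 (torusGeom (Nf n) (η n) (L n) (Mg n)) (R n) (H n)) (F3 n))
    (bout : (n : ℕ) → I → BlockNorm (toB6 (torusGeom (Nf n) (η n) (L n) (Mg n)) (R n) (H n)) (FA n))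
    (Gt : (n : ℕ) → F3 n →ₗ[ℝ] FA n) (W : (n : ℕ) → FA n →ₗ[ℝ] F3 n)
    (D2H0 : (n : ℕ) → (TPt d (N n * Mc) → ℝ) →ₗ[ℝ] F3 n)
    (H0 Hk A0 dH : (n : ℕ) → (TPt d (N n * Mc) → ℝ) →ₗ[ℝ] FA n)
    (Dfr : (n : ℕ) → FA n →ₗ[ℝ] (TPt d (N n * Mc) → ℝ)) (M₀ : ℕ → ℝ)
    (ι : (n : ℕ) → TDom d (N n) → FA n → Wn n)
    {δ₀ BG BG₂ θW cΔ A₀ A₀₂ AH₂ θD κN κ₃ : ℝ}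
    (hδ₀ : 0 < δ₀) (hσ₀ : 0 < q.σ) (hσ : q.σ ≤ δ₀ / 8) (hcR : B6.c0 δ₀ (q.σ / δ₀) ^ ν ≤ q.cR)
    (hBG : 0 ≤ BG) (hBG₂ : 0 ≤ BG₂) (hθW : 0 ≤ θW) (hcΔ : 0 ≤ cΔ) (hA₀ : 0 ≤ A₀) (hA₀₂ : 0 ≤ A₀₂)
    (hAH₂ : 0 ≤ AH₂) (hθD : 0 ≤ θD) (hM₀ : ∀ n, 0 ≤ M₀ n)
    (hκB : 1 ≤ q.κB) (hκN : ∀ n, (bN n).κ ≤ κN) (hκ₃ : ∀ n, (b3 n).κ ≤ κ₃)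
    (hG : ∀ n, HasMaj (b3 n) (bN n) (Gt n) (fun y y' => BG * Real.exp (-(δ₀ * tdist1 (Nf n) y y'))))
    (hG₂ : ∀ n i, HasMaj (b3 n) (bout n i) (Gt n) (fun y y' => BG₂ * Real.exp (-(δ₀ * tdist1 (Nf n) y y'))))
    (h189 : ∀ n, Ineq189 (bN n) (b3 n) (W n) θW δ₀)
    (hD2H0 : ∀ n, HasMaj (BlockNorm.ofBlocks (toB6 (torusGeom (Nf n) (η n) (L n) (Mg n)) (R n) (H n))
      (fun x : TPt d (N n * Mc) => e n (tcubeOf (N n) Mc x))) (b3 n) (D2H0 n)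
      (fun y y' => cΔ * Real.exp (-(δ₀ * tdist1 (Nf n) y y'))))
    (hH0 : ∀ n, HasMaj (BlockNorm.ofBlocks (toB6 (torusGeom (Nf n) (η n) (L n) (Mg n)) (R n) (H n))
      (fun x : TPt d (N n * Mc) => e n (tcubeOf (N n) Mc x))) (bN n) (H0 n)
      (fun y y' => A₀ * Real.exp (-(δ₀ * tdist1 (Nf n) y y'))))
    (hH0₂ : ∀ n i, HasMaj (BlockNorm.ofBlocks (toB6 (torusGeom (Nf n) (η n) (L n) (Mg n)) (R n) (H n))
      (fun x : TPt d (N n * Mc) => e n (tcubeOf (N n) Mc x))) (bout n i) (H0 n)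
      (fun y y' => A₀₂ * Real.exp (-(δ₀ * tdist1 (Nf n) y y'))))
    (hH₂ : ∀ n i, HasMaj (BlockNorm.ofBlocks (toB6 (torusGeom (Nf n) (η n) (L n) (Mg n)) (R n) (H n))
      (fun x : TPt d (N n * Mc) => e n (tcubeOf (N n) Mc x))) (bout n i) (Hk n)
      (fun y y' => AH₂ * Real.exp (-(δ₀ / 2 * tdist1 (Nf n) y y'))))
    (hDfr : ∀ n, HasMaj (bN n) (BlockNorm.ofBlocks (toB6 (torusGeom (Nf n) (η n) (L n) (Mg n)) (R n) (H n))
      (fun x : TPt d (N n * Mc) => e n (tcubeOf (N n) Mc x))) (Dfr n)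
      (fun y y' => θD * Real.exp (-(δ₀ / 2 * tdist1 (Nf n) y y'))))
    (h184 : ∀ n, Eq184 (A0 n) (H0 n) (Gt n) (W n) (D2H0 n))
    (h188 : ∀ n, Bound188 (BlockNorm.ofBlocks (toB6 (torusGeom (Nf n) (η n) (L n) (Mg n)) (R n) (H n))
      (fun x : TPt d (N n * Mc) => e n (tcubeOf (N n) Mc x))) (bN n) (A0 n) (M₀ n))
    (h182 : ∀ n, Eq182 (dH n) (A0 n) (H0 n) (Hk n) (Dfr n))
    (hq : qG κ₃ κN BG θW q.cR < 1)
    (hCst : (κ₃ * BG₂ * (cΔ + κN * θW * (A₀ + constA0 κ₃ κN BG θW cΔ A₀ q.cR) * q.cR) * q.cR + A₀₂) +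
        q.κB * AH₂ * (κN * θD * (constA0 κ₃ κN BG θW cΔ A₀ q.cR + A₀) * q.cR) * q.cR ≤ q.Cst)
    (hδ15 : q.δ15 ≤ δ₀)
    (hdom : ∀ n, NormDominated (S := tsys d (N n)) (bout n)
      (fun X : TDom d (N n) => (X.1.image (e n) : Finset (UT (Nf n)))) (V := fun _ => Wn n) (ι n))
    (hm : 1 ≤ q.m) (hθ : 0 ≤ q.θ) (hθM : q.θ * Mc ≤ 1) :
    Nonempty (Data190 d Mc N Wn q) :=
  ⟨{ I := I, gn := fun n => toB6 (torusGeom (Nf n) (η n) (L n) (Mg n)) (R n) (H n),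
     FBn := fun n => TPt d (N n * Mc) → ℝ, FAn := FA,
     bBn := fun n => BlockNorm.ofBlocks (toB6 (torusGeom (Nf n) (η n) (L n) (Mg n)) (R n) (H n))
       (fun x : TPt d (N n * Mc) => e n (tcubeOf (N n) Mc x)),
     boutn := bout, dHn := dH, blkn := fun n X => (X.1.image (e n) : Finset (UT (Nf n))), ιn := ι,
     un := fun _ x => Pi.single x (1 : ℝ),
     h190 := h190_of_sectG_torusGeom
       (fun n => BlockNorm.ofBlocks (toB6 (torusGeom (Nf n) (η n) (L n) (Mg n)) (R n) (H n))
         (fun x : TPt d (N n * Mc) => e n (tcubeOf (N n) Mc x)))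
       bN b3 bout Gt W D2H0 H0 Hk A0 dH Dfr M₀ hδ₀ hσ₀ hσ hcR hBG hBG₂ hθW hcΔ hA₀
       hA₀₂ hAH₂ hθD hM₀ (fun _ => hκB) hκN hκ₃ hG hG₂ h189 hD2H0 hH0 hH0₂ hH₂ hDfr h184 h188 h182 hq hCst hδ15,
     hdist := hdist_torusGeom Nf η L Mg R H,
     hrow := hrow_torusGeom Nf η L Mg R H hδ₀ hσ₀ hcR,
     hκB := fun _ => hκB, hdom := hdom,
     hm := fun n x y' => (loc_ofBlocks_single_le_one
       (g := toB6 (torusGeom (Nf n) (η n) (L n) (Mg n)) (R n) (H n)) _ x y').trans hm,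
     hD := fun n => unitFieldsLocalised_single (e n) (he n) hθ hθM }⟩

end Certificate

end Literature.MathematicalPhysics.QuantumFieldTheory.Balaban1983to89.Beta.RemainderDecay190Dictionary
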